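import Summits.ResolutionOfSingularities.ResolutionOfSingularities.Theorems.EquisingularLiftEquisingularLiftBlowupModelLinSubst
import HarnessLib

/-!
# Crux `EquisingularLift` (stmt-ResolutionOfSingularities-15660), line `Sketch` (v10c): the DEGREE-2 slice of the open residual
# `stub_blowupModel_ge_five` in EVERY characteristic, MODULO the char-free normal form of prime quadratic forms (displayed, not named)

[OURS · leafhand-res-equisingularlift-6 g2, 2026-08-31; cell `pub/decomp-res`] AI-produced, weaker than expert review; NOT a statement of any
manuscript; nothing here proves resolution of singularities in positive characteristic.  DEF-FREE; `--supports stmt-…-15660`; standard axioms.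
CONDITIONAL on the displayed hypothesis `NF` (the classical normal form of quadrics over an algebraically closed field of ANY characteristic,
Hartshorne I Ex. 5.12 / Dieudonné, «La géométrie des groupes classiques» I §16: split off the singular radical `{v ∈ rad b_F | F(v) = 0}`; it is NOT a
named fact of the tree and NOT proved here — it is (q2) of the lh6 g0 / g2 census, pure linear algebra, M–L).

* `prime_aeval_of_linSubst`, `isHomogeneous_two_aeval_of_linSubst` — an invertible linear substitution preserves primality and (quadratic) forms;
* ★ `blowupModel_of_range_eq_quadric_of_normalForm` — **IF every prime quadratic form `F ∈ k[x₀, …, x_{n+1}]` becomes, under some invertible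
  linear substitution, EITHER a nonsingular form OR a coordinate cone `G(x_{ι 0}, …, x_{ι (m+1)})` (`m ≥ 1`) over a nonsingular quadratic form `G`
  with complementary idle variables `x_{e 0}, …, x_{e r}` (hypothesis `NF`, displayed verbatim), THEN every `(H, ι)` of the crux with
  `range ι = V₊(F)`, `F` a prime quadratic form, has a regular blow-up model** — the conclusion of `stub_blowupModel_ge_five` at ALL integral
  quadric hypersurfaces, in EVERY characteristic and every dimension (✓ `exists_closedImmersion_range_eq_of_linSubst`,
  ✓ `blowupModel_of_range_eq_of_isNonsingularForm`, ✓ `blowupModel_of_range_eq_of_linSubst_linCone` over seat res-D-pv-013's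
  ✓ `LinCone.isRegular_of_isBlowup_comap` / `Cone.isRegularRing_quotient_aeval_update_one_of_isNonsingularForm`).

So the degree-2 slice of the residual now hinges on ONE displayed statement of linear algebra.  Honest: no registered stub closed; `NF` open in the tree.

References: [Hartshorne1977, I Ex. 5.12, II Ex. 7.12]; J. Dieudonné, *La géométrie des groupes classiques* (1955), I §16 (quadratic forms in
characteristic 2) — index only.
-/

set_option linter.dupNamespace false -- mandated namespace `Summit.<Summit>.<Problem>` of this single-conjunct summit

noncomputable section

open CategoryTheory CategoryTheory.Limits AlgebraicGeometry TopologicalSpace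
open MvPolynomial HomogeneousLocalization
open Literature.AlgebraicGeometry.Resolution
open Literature.AlgebraicGeometry.Motives Literature.AlgebraicGeometry.Motives.SmoothHypersurface
open Literature.AlgebraicGeometry.Motives.ProjectiveSpace
open AlgebraicGeometry.Scheme.IdealSheafData
open Summit.ResolutionOfSingularities.ResolutionOfSingularities.Cruxes.EquisingularLiftNat.Sections

universe u

namespace Summit.ResolutionOfSingularities.ResolutionOfSingularities.Cruxes.EquisingularLift.StrataSplit

section LinSubstAlgebra

variable {k : Type} [Field k] {n : ℕ} (τ τ' : Fin (n + 1 + 1) → MvPolynomial (Fin (n + 1 + 1)) k)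
  (hτ' : ∀ i, (τ' i).IsHomogeneous 1) (hinv : ∀ i, aeval τ (τ' i) = X i) (hinv' : ∀ i, aeval τ' (τ i) = X i)

include hinv hinv' in
/-- **An invertible linear substitution preserves primality** (`aeval τ'` is a ring automorphism with inverse `aeval τ`). [folklore] -/
theorem prime_aeval_of_linSubst {F : MvPolynomial (Fin (n + 1 + 1)) k} (hF : Prime F) : Prime (aeval τ' F) := by
  have h1 : (aeval τ).comp (aeval τ') = AlgHom.id k (MvPolynomial (Fin (n + 1 + 1)) k) :=
    MvPolynomial.algHom_ext fun i => by rw [AlgHom.comp_apply, aeval_X, hinv, AlgHom.id_apply]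
  have h2 : (aeval τ').comp (aeval τ) = AlgHom.id k (MvPolynomial (Fin (n + 1 + 1)) k) :=
    MvPolynomial.algHom_ext fun i => by rw [AlgHom.comp_apply, aeval_X, hinv', AlgHom.id_apply]
  let E : MvPolynomial (Fin (n + 1 + 1)) k ≃ₐ[k] MvPolynomial (Fin (n + 1 + 1)) k := AlgEquiv.ofAlgHom (aeval τ') (aeval τ) h2 h1
  exact (MulEquiv.prime_iff E).mpr hF

include hτ' in
/-- **A linear substitution preserves forms of degree `2`** (Mathlib `IsHomogeneous.aeval`). [folklore] -/
theorem isHomogeneous_two_aeval_of_linSubst {F : MvPolynomial (Fin (n + 1 + 1)) k} (hF : F.IsHomogeneous 2) :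
    (aeval τ' F).IsHomogeneous 2 := by
  have h := hF.aeval τ' hτ'
  rwa [one_mul] at h

end LinSubstAlgebra

/-- ★ **The degree-2 slice of the open residual, modulo the char-free normal form of quadrics.**  IF (hypothesis `NF`, displayed — the classical
normal form over an algebraically closed field of any characteristic, NOT proved in the tree): every PRIME quadratic form `F ∈ k[x₀, …, x_{n+1}]`
admits mutually inverse linear substitutions `τ, τ'` such that `σ_{τ'} F` is EITHER a nonsingular form OR `G(x_{ι 0}, …, x_{ι (m+1)})` for a
nonsingular quadratic form `G` in `m + 2 ≥ 3` variables and complementary injections `ι, e` — THEN for every `(H, ι_H)` of the crux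
(`ι_H : H ↪ ℙⁿ⁺¹_k` closed immersion, `H` integral) with `range ι_H = V₊(F)`, `F` a prime quadratic form, `H` carries a non-zero ideal sheaf all of
whose blow-ups are regular: the conclusion of `stub_blowupModel_ge_five` at EVERY integral quadric hypersurface, every characteristic, every `n`.
[cite: Hartshorne1977, I Ex. 5.12 and II Ex. 7.12] -/
theorem blowupModel_of_range_eq_quadric_of_normalForm {k : Type} [Field k] {n : ℕ}
    (NF : ∀ F : MvPolynomial (Fin (n + 1 + 1)) k, F.IsHomogeneous 2 → Prime F →
      ∃ (τ τ' : Fin (n + 1 + 1) → MvPolynomial (Fin (n + 1 + 1)) k) (_ : ∀ i, (τ i).IsHomogeneous 1)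
        (_ : ∀ i, (τ' i).IsHomogeneous 1) (_ : ∀ i, aeval τ (τ' i) = X i) (_ : ∀ i, aeval τ' (τ i) = X i),
        IsNonsingularForm k (aeval τ' F) ∨
          ∃ (m r : ℕ) (ι : Fin (m + 2) → Fin (n + 1 + 1)) (e : Fin (r + 1) → Fin (n + 1 + 1))
            (G : MvPolynomial (Fin (m + 2)) k), 1 ≤ m ∧ Function.Injective ι ∧ Function.Injective e ∧
              (∀ l, ι l ∉ Set.range e) ∧ (∀ a, a ∉ Set.range e → a ∈ Set.range ι) ∧
              G.IsHomogeneous 2 ∧ IsNonsingularForm k G ∧ aeval τ' F = rename ι G)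
    {H : Scheme.{0}} (ιH : H ⟶ (projectiveSpace (n + 1) k).left) [IsClosedImmersion ιH] [IsIntegral H]
    (F : MvPolynomial (Fin (n + 1 + 1)) k) (hF : F.IsHomogeneous 2) (hprime : Prime F)
    (hrange : letI := MvPolynomial.gradedAlgebra (σ := Fin (n + 1 + 1)) (R := k)
      Set.range ιH = {x : Proj (homogeneousSubmodule (Fin (n + 1 + 1)) k) | F ∈ x.asHomogeneousIdeal}) :
    ∃ 𝔞 : H.IdealSheafData, 𝔞 ≠ ⊥ ∧ ∀ (Z : Scheme.{0}) (π : Z ⟶ H), IsBlowup π 𝔞 → Scheme.IsRegular Z := by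
  letI := MvPolynomial.gradedAlgebra (σ := Fin (n + 1 + 1)) (R := k)
  obtain ⟨τ, τ', hτ, hτ', hinv, hinv', hcases⟩ := NF F hF hprime
  rcases hcases with hns | ⟨m, r, ι, e, G, hm, hι, he, hιe, heι, hG, hGns, hFG⟩
  · -- full rank: `V₊(F) ≅ V₊(σ_{τ'} F)` is regular
    obtain ⟨ι₁, hι₁, hrange₁⟩ := exists_closedImmersion_range_eq_of_linSubst τ τ' hτ hτ' hinv hinv' ιH F hrange
    haveI := hι₁
    exact blowupModel_of_range_eq_of_isNonsingularForm ι₁ (aeval τ' F) (isHomogeneous_two_aeval_of_linSubst τ' hτ' hF) two_pos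
      (prime_aeval_of_linSubst τ τ' hinv hinv' hprime) hns hrange₁
  · -- a cone with linear vertex `ℙʳ` over the nonsingular quadric `G`
    exact blowupModel_of_range_eq_of_linSubst_linCone ιH F hrange τ τ' hτ hτ' hinv hinv' ι hι e he hιe heι G hG
      (hGns.prime hm (by norm_num) hG) (fun i => Cone.isRegularRing_quotient_aeval_update_one_of_isNonsingularForm k G hG hGns i) hFG

end Summit.ResolutionOfSingularities.ResolutionOfSingularities.Cruxes.EquisingularLift.StrataSplit

end
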